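import Summits.Langlands.Langlands.Theses.ExteriorSquareAscent
import Literature.NumberTheory.Automorphic.AutomorphicRepsGLLogDetCounterexample
import Literature.NumberTheory.Automorphic.PairLFunctionPoles
import HarnessLib

/-!
# `PairLPoleJS` — negative lane: the rank guard `0 < n` is load-bearing

Refuter-side support for the crux `PairLPoleJS` (item stmt-Langlands-19093; Arthur–Clozel Ch. 3 §2 (2.3) for
Borel–Jacquet data), cycle 1 of the standing disprover (`Cruxes/PairLPoleJS/Disproof.lean` §(a)). No
statement of the route is proved or refuted.

* `exists_glZero_hasSatakeParamAt_zero` — `GL_0(𝔸_ℚ)` is the trivial group; the constants `ℂ · 1` over `0`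
  form a `CuspidalAutomorphicRepData 0 ℚ hcpt` whose Satake parameter at every finite place is the EMPTY
  multiset (the witness pattern of the tree's `OrdinaryPrimeTransportRankinSelbergPoleCount_refuted`,
  stmt-Langlands-17212, re-proved here as a reusable datum).
* `pairLPoleJS_false_without_pos` — the crux with `0 < n` dropped (verbatim otherwise) is FALSE at `n = 0`:
  `α = β = ∅` are Satake parameters of that datum, unitary (`|∏ ∅| = 1`) and in `X` (`∅ = ∅`), every local
  factor is `P(∅, ∅; x)⁻¹ = 1`, so `L ≡ 1` and `(s - 1) · 1 → 0`: no non-zero limit. The guard excludes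
  exactly this degenerate rank.
-/

noncomputable section

set_option linter.dupNamespace false -- project-wide option (lakefile weak.linter.dupNamespace); `Summit.Langlands.Langlands` is the mandated namespace

open scoped Topology MatrixGroups
open NumberField IsDedekindDomain MeasureTheory Filter
open Literature.NumberTheory.Automorphic AdelicGroupData
open Literature.NumberTheory.GaloisRepresentations

namespace Summit.Langlands.Langlands.Theorems.PairLPoleJS.Negative

/-- **The constant datum on `GL_0`.** `GL_0(𝔸_ℚ)` is the trivial group, the constants `ℂ · 1` are cusp
forms (Borel–Jacquet 4.2 (a)–(d) hold trivially and the cusp condition `0 < k < 0` is empty), so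
`π₀ = ℂ·1 / 0` is a `CuspidalAutomorphicRepData 0 ℚ hcpt`; its Satake parameter at every finite place is
the EMPTY multiset (the only Hecke operator `[K(𝔫) t_{v,0} K(𝔫)] = [K(𝔫)]` is the identity). This is the
witness of the tree's `OrdinaryPrimeTransportRankinSelbergPoleCount_refuted` (stmt-Langlands-17212),
re-proved here. [folklore] -/
theorem exists_glZero_hasSatakeParamAt_zero (hcpt : isCompact_glFiniteIntegralLevel 0 ℚ) :
    ∃ π₀ : CuspidalAutomorphicRepData 0 ℚ hcpt, ∀ v : HeightOneSpectrum (𝓞 ℚ), π₀.1.HasSatakeParamAt v 0 := by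
  classical
  -- `GL_0(𝔸_ℚ)` is the trivial group
  haveI hsub : Subsingleton ((AdelicGroupData.gl 0 ℚ).Adelic) := by
    change Subsingleton (GL (Fin 0) (AdeleRing (𝓞 ℚ) ℚ))
    infer_instance
  -- (1) the constant `1` is an automorphic form on `GL_0(𝔸_ℚ)` (BJ 4.2; growth with `C = 1`, `r = 0`)
  have hA : IsAutomorphicForm (AutomorphyDatum.gl 0 ℚ hcpt)
      (1 : (AdelicGroupData.gl 0 ℚ).Adelic → ℂ) :=
    { leftInvariant := isLeftInvariant_affLogDet one_eq_aff
      exists_level := by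
        obtain ⟨U, hU⟩ := finiteLevelsGL_nonempty 0 ℚ hcpt
        exact ⟨U, hU, isRightInvariantUnder_affLogDet one_eq_aff hU⟩
      archSmooth := isArchSmooth_affLogDet one_eq_aff
      kFinite := isKFinite_affLogDet one_eq_aff
      zFinite := isZFinite_affLogDet one_eq_aff
      moderateGrowth := ⟨1, 0, fun g => by simp⟩ }
  -- (2) `ℂ · 1` and `0` are stable spaces of automorphic forms, `ℂ · 1` consists of cusp forms
  have hS1 : IsStableSubmodule (AutomorphyDatum.gl 0 ℚ hcpt)
      (Submodule.span ℂ {(1 : (AdelicGroupData.gl 0 ℚ).Adelic → ℂ)}) :=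
    { le_automorphicForms := Submodule.span_le.2 (by
        rintro θ rfl
        exact hA.mem_automorphicForms)
      finite_stable := fun h' _ => span_one_le_comap_rightTranslation h'
      k_stable := fun k => span_one_le_comap_rightTranslation _
      lie_stable := fun X θ hθ => by
        obtain ⟨c, rfl⟩ := Submodule.mem_span_singleton.1 hθ
        rw [lieDeriv_smul, lieDeriv_one_gl, smul_zero]
        exact Submodule.zero_mem _ }
  have hS0 : IsStableSubmodule (AutomorphyDatum.gl 0 ℚ hcpt)
      (⊥ : Submodule ℂ ((AdelicGroupData.gl 0 ℚ).Adelic → ℂ)) :=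
    { le_automorphicForms := bot_le
      finite_stable := fun _ _ => bot_le
      k_stable := fun _ => bot_le
      lie_stable := fun X θ hθ => by
        rw [(Submodule.mem_bot ℂ).1 hθ]
        have h0 : lieDeriv (AutomorphyDatum.gl 0 ℚ hcpt).ofArch X
            (0 : (AdelicGroupData.gl 0 ℚ).Adelic → ℂ) = 0 := by
          funext g
          simp [lieDeriv]
        rw [h0]
        exact Submodule.zero_mem _ }
  have hcusp : Submodule.span ℂ {(1 : (AdelicGroupData.gl 0 ℚ).Adelic → ℂ)} ≤ cuspFormsGL 0 ℚ hcpt := by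
    refine Submodule.span_le.2 ?_
    rintro θ rfl
    exact IsCuspFormGL.mem_cuspFormsGL ⟨hA, fun k hk hk0 => absurd hk0 (by omega)⟩
  -- (3) the cuspidal datum `π₀ = ℂ · 1 / 0` (a line, hence irreducible)
  obtain ⟨π₀, hW, hW'⟩ : ∃ π₀ : CuspidalAutomorphicRepData 0 ℚ hcpt,
      π₀.1.W = Submodule.span ℂ {(1 : (AdelicGroupData.gl 0 ℚ).Adelic → ℂ)} ∧ π₀.1.W' = ⊥ :=
    ⟨⟨{ W := Submodule.span ℂ {(1 : (AdelicGroupData.gl 0 ℚ).Adelic → ℂ)}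
        W' := ⊥
        lt := bot_lt_iff_ne_bot.2 (by
          rw [Ne, Submodule.span_singleton_eq_bot]
          exact one_ne_zero)
        stable := hS1
        stable' := hS0
        irreducible := fun W'' _ h₂ _ =>
          (nonzero_span_atom (1 : (AdelicGroupData.gl 0 ℚ).Adelic → ℂ) one_ne_zero).le_iff.1 h₂ },
      hcusp⟩, rfl, rfl⟩
  -- (4) on the trivial group every double-coset Hecke operator `[U g U] = [U]` is the identity
  have hHecke : ∀ (U : Subgroup (AdelicGroupData.gl 0 ℚ).Adelic) (g : (AdelicGroupData.gl 0 ℚ).Adelic)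
      (φ : (AdelicGroupData.gl 0 ℚ).Adelic → ℂ),
      heckeOperator (rightTranslation (AdelicGroupData.gl 0 ℚ)) U g φ = φ := by
    intro U g φ
    have hφ : φ ∈ (rightTranslation (AdelicGroupData.gl 0 ℚ)).fixedPoints U := by
      rw [← isRightInvariantUnder_iff_mem_fixedPoints]
      intro u _ x
      rw [Subsingleton.elim (x * u) x]
    have hall : ∀ y : (AdelicGroupData.gl 0 ℚ).Adelic ⧸ U,
        y = ((1 : (AdelicGroupData.gl 0 ℚ).Adelic) : (AdelicGroupData.gl 0 ℚ).Adelic ⧸ U) :=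
      fun y => QuotientGroup.induction_on y fun z => congrArg _ (Subsingleton.elim z 1)
    have hs : Set.BijOn (fun x : (AdelicGroupData.gl 0 ℚ).Adelic => (x : (AdelicGroupData.gl 0 ℚ).Adelic ⧸ U))
        (({1} : Finset (AdelicGroupData.gl 0 ℚ).Adelic) : Set (AdelicGroupData.gl 0 ℚ).Adelic)
        (MulAction.orbit U (g : (AdelicGroupData.gl 0 ℚ).Adelic ⧸ U)) := by
      refine ⟨?_, ?_, ?_⟩
      · intro x _
        show (x : (AdelicGroupData.gl 0 ℚ).Adelic ⧸ U) ∈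
          MulAction.orbit U (g : (AdelicGroupData.gl 0 ℚ).Adelic ⧸ U)
        rw [hall (x : (AdelicGroupData.gl 0 ℚ).Adelic ⧸ U), ← hall (g : (AdelicGroupData.gl 0 ℚ).Adelic ⧸ U)]
        exact MulAction.mem_orbit_self _
      · simp
      · intro y _
        exact ⟨1, Finset.mem_coe.2 (Finset.mem_singleton_self _), (hall y).symm⟩
    rw [heckeOperator_apply_eq_sum _ U g {1} hs hφ, Finset.sum_singleton, map_one, Module.End.one_apply]
  -- (5) `π₀` has the empty Satake parameter at every finite place (level `1`, eigenform `1`)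
  refine ⟨π₀, fun v => ?_⟩
  obtain ⟨ϖ₀, hϖ₀⟩ := v.valuation_exists_uniformizer ℚ
  have hval' : Valued.v (algebraMap ℚ (v.adicCompletion ℚ) ϖ₀) = v.valuation ℚ ϖ₀ :=
    HeightOneSpectrum.valuedAdicCompletion_eq_valuation' v ϖ₀
  have hval : Valued.v (algebraMap ℚ (v.adicCompletion ℚ) ϖ₀) = WithZero.exp (-1 : ℤ) := by
    rw [hval', hϖ₀]
  have hne : algebraMap ℚ (v.adicCompletion ℚ) ϖ₀ ≠ 0 := fun h0 => by
    rw [h0, map_zero] at hval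
    exact WithZero.coe_ne_zero hval.symm
  refine ⟨⊤, Units.mk0 _ hne, ?_, ?_, hval, rfl, 1, ?_, ?_, ?_, ?_⟩
  · simp
  · intro hdvd
    exact v.isPrime.ne_top (top_le_iff.1 (Ideal.dvd_iff_le.1 hdvd))
  · rw [hW]
    exact Submodule.mem_span_singleton_self _
  · rw [hW', Submodule.mem_bot]
    exact one_ne_zero
  · intro u _
    rfl
  · intro i hi
    obtain rfl : i = 0 := Nat.le_zero.1 hi
    rw [hW', Submodule.mem_bot, hHecke]
    have h1 : ((((Real.sqrt (v.residueCard : ℝ)) : ℝ) : ℂ) ^ (0 * (0 - 0)) *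
        (0 : Multiset ℂ).esymm 0) = 1 := by
      simp [Multiset.esymm]
    rw [h1, one_smul, sub_self]

/-- **`0 < n` is load-bearing.** Witness: `n = 0`, `F = ℚ`, `π = π' = ℂ·1/0` on `GL_0(𝔸_ℚ) = 1`
(`exists_glZero_hasSatakeParamAt_zero`), `S = S₀`, `α = β = ∅` (Satake parameters of `π₀`, unitary:
`|∏ ∅| = 1`, and in `X`: `∅ = ∅`), `s₀ = 1`: every local factor is `P(∅, ∅; x)⁻¹ = 1`, so `L ≡ 1` and
`(s - 1) · 1 → 0`: no non-zero limit. [folklore] -/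
theorem pairLPoleJS_false_without_pos :
    ¬ (∀ (n : ℕ) (F : Type) [Field F] [NumberField F] (hF : isCompact_glFiniteIntegralLevel n F),
        ∀ (π π' : CuspidalAutomorphicRepData n F hF),
        ∃ S₀ : Set (HeightOneSpectrum (𝓞 F)), S₀.Finite ∧
          ∀ {S : Set (HeightOneSpectrum (𝓞 F))}, S.Finite → S₀ ⊆ S →
          ∀ {α β : HeightOneSpectrum (𝓞 F) → Multiset ℂ},
            (∀ w ∉ S, π.1.HasSatakeParamAt w (α w)) → (∀ w ∉ S, π'.1.HasSatakeParamAt w (β w)) →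
            (∀ w ∉ S, ‖(α w).prod‖ = 1) → (∀ w ∉ S, ‖(β w).prod‖ = 1) →
            ∀ {s₀ : ℂ}, s₀.re = 1 →
              (∀ᶠ w in cofinite, (α w).map ((((w.residueCard : ℂ) ^ (1 - s₀))) * ·) = (β w).map (·⁻¹)) →
              ∃ c : ℂ, c ≠ 0 ∧ Tendsto (fun s : ℂ => (s - s₀) *
                ∏' w : {w : HeightOneSpectrum (𝓞 F) // w ∉ S},
                  ((satakePairPolynomial (α w.1) (β w.1)).eval ((w.1.residueCard : ℂ) ^ (-s)))⁻¹)
                (𝓝[{s : ℂ | 1 < s.re}] s₀) (𝓝 c)) := by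
  intro h
  have hcpt : isCompact_glFiniteIntegralLevel 0 ℚ := isCompact_glFiniteIntegralLevel_holds 0 ℚ
  obtain ⟨π₀, hSat⟩ := exists_glZero_hasSatakeParamAt_zero hcpt
  obtain ⟨S₀, hS₀, hmain⟩ := h 0 ℚ hcpt π₀ π₀
  obtain ⟨c, hc, hlim⟩ := hmain hS₀ subset_rfl
    (α := fun _ => (0 : Multiset ℂ)) (β := fun _ => (0 : Multiset ℂ))
    (fun w _ => hSat w) (fun w _ => hSat w) (fun w _ => by simp) (fun w _ => by simp)
    (s₀ := 1) Complex.one_re (Filter.Eventually.of_forall fun w => by simp)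
  have h0 : Tendsto (fun s : ℂ => (s - 1) *
      ∏' w : {w : HeightOneSpectrum (𝓞 ℚ) // w ∉ S₀},
        ((satakePairPolynomial ((fun _ => (0 : Multiset ℂ)) w.1)
          ((fun _ => (0 : Multiset ℂ)) w.1)).eval ((w.1.residueCard : ℂ) ^ (-s)))⁻¹)
      (𝓝[{s : ℂ | 1 < s.re}] 1) (𝓝 0) := by
    have h1 : ∀ s : ℂ, (∏' w : {w : HeightOneSpectrum (𝓞 ℚ) // w ∉ S₀},
        ((satakePairPolynomial ((fun _ => (0 : Multiset ℂ)) w.1)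
          ((fun _ => (0 : Multiset ℂ)) w.1)).eval ((w.1.residueCard : ℂ) ^ (-s)))⁻¹) = 1 := by
      intro s
      simp [satakePairPolynomial]
    simp only [h1, mul_one]
    exact tendsto_sub_one_nhdsWithin_one_lt_re
  exact hc (tendsto_nhds_unique hlim h0)

end Summit.Langlands.Langlands.Theorems.PairLPoleJS.Negative

end
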